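import Summits.RiemannHypothesis.RiemannHypothesis.Theses.WeilComb
import Summits.RiemannHypothesis.RiemannHypothesis.Theorems.WeilCombCombSubcriticalEffectiveAux
import Summits.RiemannHypothesis.RiemannHypothesis.Theorems.WeilCombCombSubcriticalStubAutocorrelation
import Summits.RiemannHypothesis.RiemannHypothesis.Theorems.WeilCombCombSubcriticalStubPrime
import Summits.RiemannHypothesis.RiemannHypothesis.Theorems.WeilCombCombSubcriticalStubPolar
import Summits.RiemannHypothesis.RiemannHypothesis.Theorems.WeilCombCombSubcriticalStubArchOffdiag
import Summits.RiemannHypothesis.RiemannHypothesis.Theorems.WeilCombCombSubcriticalStubIdentity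
import Summits.RiemannHypothesis.RiemannHypothesis.Theorems.WeilCombCombShapePositivitySharpArchDiag
import Summits.RiemannHypothesis.RiemannHypothesis.Theorems.WeilCombCombShapePositivityStubSubArith
import Literature.NumberTheory.LFunctions.WeilExplicit
import Literature.NumberTheory.LFunctions.WeilMellinBounds
import Literature.NumberTheory.LFunctions.WeilArchimedeanMoments

/-!
# Effective Theorem A for a general shape: Weil positivity of log-integer combs on the window `εM ≤ 1/128`
(crux `WeilComb.CombShapePositivity` / sibling crux `WeilComb.CombSubcritical`, item stmt-RiemannHypothesis-11229, line `Sketch`)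

**Theorem** (`combSubcritical_effective`). For every Weil test `φ` with `tsupport φ ⊆ [-1, 1]`, every `ε > 0`, `M : ℕ`,
`a : ℕ → ℂ` with `ε·M ≤ 1/128`, the comb `g = Σ_{m ≤ M} a_m φ_ε(· − log m)`, `φ_ε(t) = ε⁻¹ φ(t/ε)`, has `0 ≤ Re W(g ⋆ g̃)`.
This is the route's Theorem A (`WeilComb.CombSubcritical`, proved in tree with an inexplicit universal `c₀`) with the
EXPLICIT universal window constant `c₀ = 1/128` (`combSubcritical_effective_implies` records the implication).

Proof = zeros-free explicit-formula bookkeeping with the sharp `log M` coefficient, entirely from landed general-`φ` pieces: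
`Q = P − Pr + W_∞` (definition); `Pr = ε⁻¹‖φ‖₂²·H(a)` EXACTLY for `8εM ≤ 1` (`WeilCombSubcritical.stub_prime`);
`Re P ≥ −5‖φ‖₂² A_m A_p` (`stub_polar`); `W_∞(k) = Σ_{m,m'} a ā' W_∞(τ_x ψ_ε)` (`stub_autocorrelation` + linearity), whose diagonal
is `≥ ‖a‖²[ε⁻¹‖φ‖₂²(log(1/ε) − 5/2) − ‖φ‖₂²(9 + 3 log(1/ε))]` (`re_weilArchTerm_autocorr_ge_sharp`) and whose off-diagonal entries have
`|W_∞(τ_x ψ_ε)| ≤ ‖φ‖₁²(1/|x| + 1)` (`stub_archOffdiag`, `|x| ≥ 1/M ≥ 4ε`); `H = Σ‖a_m‖²(log m + ψ₁(M/m)) − D` (`stub_identity`),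
the explicit Poincaré / Schur / pole-shadow / Helson-potential inequalities (`stub_subArith`), `‖φ‖₁² ≤ 2‖φ‖₂²`, and the
arithmetic `assemble_gen` (budget `log 128 − 5/2 − 1 − 0.91 > 0`).
-/

noncomputable section

set_option linter.dupNamespace false

open scoped BigOperators ComplexConjugate
open Complex MeasureTheory Set

namespace Summit.RiemannHypothesis.RiemannHypothesis.Theorems.WeilCombBohrFejer

open Literature.NumberTheory.LFunctions
open Summit.RiemannHypothesis.RiemannHypothesis.Theorems.WeilCombSubcritical

/-- **Effective Theorem A (general shape).** For every Weil test `φ` supported in `[-1,1]`, `ε > 0`, `M`, `a` with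
`εM ≤ 1/128`: `0 ≤ Re W(g ⋆ g̃)` for the comb `g = Σ_{m≤M} a_m ε⁻¹φ((· − log m)/ε)`. [folklore] -/
theorem combSubcritical_effective : ∀ φ : ℝ → ℂ, IsWeilTest φ → tsupport φ ⊆ Set.Icc (-1) 1 →
    ∀ ε : ℝ, 0 < ε → ∀ (M : ℕ) (a : ℕ → ℂ), ε * M ≤ 1 / 128 →
    0 ≤ (weilQuadratic (fun x : ℝ => ∑ m ∈ Finset.Icc 1 M,
        a m * ((ε : ℂ)⁻¹ * φ ((x - Real.log (m : ℝ)) / ε)))).re := by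
  intro φ hφ hsupp ε hε M a hlam
  rcases Nat.eq_zero_or_pos M with hM0 | hMpos
  · subst hM0
    have h0 : (fun x : ℝ => ∑ m ∈ Finset.Icc 1 0, a m * ((ε : ℂ)⁻¹ * φ ((x - Real.log (m : ℝ)) / ε))) = 0 := by
      funext x
      simp
    rw [h0, weilQuadratic_zero]
    simp
  have hM : 1 ≤ M := hMpos
  have hMr : (1 : ℝ) ≤ (M : ℝ) := by exact_mod_cast hM
  have hM0r : (0 : ℝ) < (M : ℝ) := by linarith
  have h8 : 8 * ε * M ≤ 1 := by nlinarith
  have hε8 : ε ≤ 1 / 8 := by nlinarith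
  have hε4 : ε ≤ 1 / 4 := by nlinarith
  have h4M : 4 * ε ≤ 1 / (M : ℝ) := by
    rw [le_div_iff₀ hM0r]
    nlinarith
  -- names
  set φε : ℝ → ℂ := fun t : ℝ => (ε : ℂ)⁻¹ * φ (t / ε) with hφε
  set ψε : ℝ → ℂ := weilConv φε (weilReflect φε) with hψε
  set N : ℝ := weilNorm2Sq φ with hN
  set I : ℝ := weilNorm1 φ with hI
  set L : ℝ := ∑ m ∈ Finset.Icc 1 M, ‖a m‖ ^ 2 with hL
  set H : ℝ := 2 * (∑ m ∈ Finset.Icc 1 M, ∑ n ∈ Finset.Icc 1 (M / m),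
      ((ArithmeticFunction.vonMangoldt n : ℝ) : ℂ) / (Real.sqrt n : ℂ) * a (n * m) *
        conj (a m)).re with hH
  set V : ℝ := ∑ m ∈ Finset.Icc 1 M, ‖a m‖ ^ 2 *
      (Real.log m + ∑ n ∈ Finset.Icc 1 (M / m), (ArithmeticFunction.vonMangoldt n : ℝ) / n) with hV
  set D : ℝ := ∑ m ∈ Finset.Icc 1 M, ∑ n ∈ Finset.Icc 1 (M / m),
      (ArithmeticFunction.vonMangoldt n : ℝ) * ‖a (n * m) - ((Real.sqrt n : ℂ))⁻¹ * a m‖ ^ 2 with hD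
  set Qp : ℝ := ∑ m ∈ Finset.Icc 1 M, (m : ℝ) * Real.log m * ‖a m‖ ^ 2 with hQp
  set B : ℝ := ∑ m ∈ Finset.Icc 1 M, ∑ m' ∈ (Finset.Icc 1 M).erase m,
      ‖a m‖ * ‖a m'‖ / |Real.log m - Real.log m'| with hB
  set S : ℝ := ∑ m ∈ Finset.Icc 1 M, ‖a m‖ with hS
  set Am : ℝ := ∑ m ∈ Finset.Icc 1 M, ‖a m‖ / Real.sqrt m with hAm
  set Ap : ℝ := ∑ m ∈ Finset.Icc 1 M, ‖a m‖ * Real.sqrt m with hAp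
  set Wd : ℝ := (weilArchTerm ψε).re with hWd
  set Off : ℝ := (∑ m ∈ Finset.Icc 1 M, ∑ m' ∈ (Finset.Icc 1 M).erase m,
      a m * conj (a m') * weilArchTerm (weilTranslate ψε (Real.log (m : ℝ) - Real.log (m' : ℝ)))).re
    with hOff
  -- the landed general-φ pieces
  have hA := stub_autocorrelation
  have hk := hA φ hφ ε hε M a
  have hPrime := stub_prime hA φ hφ hsupp ε hε M a hM h8
  have hP : -(5 * N * (Am * Ap)) ≤ (weilPolarTerm (weilConv (fun x : ℝ => ∑ m ∈ Finset.Icc 1 M,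
          a m * ((ε : ℂ)⁻¹ * φ ((x - Real.log (m : ℝ)) / ε)))
        (weilReflect (fun x : ℝ => ∑ m ∈ Finset.Icc 1 M,
          a m * ((ε : ℂ)⁻¹ * φ ((x - Real.log (m : ℝ)) / ε)))))).re := by
    have h := stub_polar φ hφ hsupp ε hε hε8 M a
    have e : 5 * N * (Am * Ap) = 5 * N * Am * Ap := by ring
    rw [e]
    exact h
  obtain ⟨hPoinc, hBle, hA2, hVle⟩ := stub_subArith M a
  have hId := stub_identity M a
  have hφεW : IsWeilTest φε := isWeilTest_dil hφ hε.ne'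
  have hsε : tsupport φε ⊆ Icc (-ε) ε := tsupport_dil_subset hsupp hε
  have hψW : IsWeilTest ψε := hφεW.weilConv hφεW.weilReflect
  have hI2 : I ^ 2 ≤ 2 * N := by
    have h := weilNorm1_sq_le hφ one_pos hsupp
    rw [← hI, ← hN] at h
    linarith
  -- Step 1: the archimedean Gram expansion `W_∞(k) = Σ_{m,m'} a ā' W_∞(τ_x ψ_ε)`
  have hArch : weilArchTerm (weilConv (fun x : ℝ => ∑ m ∈ Finset.Icc 1 M,
        a m * ((ε : ℂ)⁻¹ * φ ((x - Real.log (m : ℝ)) / ε)))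
      (weilReflect (fun x : ℝ => ∑ m ∈ Finset.Icc 1 M,
        a m * ((ε : ℂ)⁻¹ * φ ((x - Real.log (m : ℝ)) / ε))))) =
      ∑ m ∈ Finset.Icc 1 M, ∑ m' ∈ Finset.Icc 1 M, a m * conj (a m') *
        weilArchTerm (weilTranslate ψε (Real.log (m : ℝ) - Real.log (m' : ℝ))) := by
    rw [hk]
    have hT : ∀ m m' : ℕ, IsWeilTest (fun t : ℝ => a m * conj (a m') *
        weilTranslate ψε (Real.log (m : ℝ) - Real.log (m' : ℝ)) t) :=
      fun m m' => (hψW.weilTranslate _).const_mul _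
    have hrow : ∀ m : ℕ, IsWeilTest (fun t : ℝ => ∑ m' ∈ Finset.Icc 1 M, a m * conj (a m') *
        weilTranslate ψε (Real.log (m : ℝ) - Real.log (m' : ℝ)) t) :=
      fun m => isWeilTest_finset_sum (Finset.Icc 1 M)
        (fun m' => fun t : ℝ => a m * conj (a m') * weilTranslate ψε (Real.log (m : ℝ) - Real.log (m' : ℝ)) t)
        (fun m' _ => hT m m')
    rw [weilArchTerm_finset_sum (Finset.Icc 1 M)
      (fun m => fun t : ℝ => ∑ m' ∈ Finset.Icc 1 M, a m * conj (a m') *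
        weilTranslate ψε (Real.log (m : ℝ) - Real.log (m' : ℝ)) t) (fun m _ => hrow m)]
    refine Finset.sum_congr rfl fun m _ => ?_
    rw [weilArchTerm_finset_sum (Finset.Icc 1 M)
      (fun m' => fun t : ℝ => a m * conj (a m') * weilTranslate ψε (Real.log (m : ℝ) - Real.log (m' : ℝ)) t)
      (fun m' _ => hT m m')]
    refine Finset.sum_congr rfl fun m' _ => ?_
    exact weilArchTerm_const_mul _ _
  -- Step 2: split diagonal / off-diagonal
  have hdiagsplit : (weilArchTerm (weilConv (fun x : ℝ => ∑ m ∈ Finset.Icc 1 M,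
        a m * ((ε : ℂ)⁻¹ * φ ((x - Real.log (m : ℝ)) / ε)))
      (weilReflect (fun x : ℝ => ∑ m ∈ Finset.Icc 1 M,
        a m * ((ε : ℂ)⁻¹ * φ ((x - Real.log (m : ℝ)) / ε)))))).re = L * Wd + Off := by
    rw [hArch]
    have hT0 : ∀ h : ℝ → ℂ, weilTranslate h 0 = h := fun h => funext fun t => by simp [weilTranslate]
    have e : ∀ m ∈ Finset.Icc 1 M,
        ∑ m' ∈ Finset.Icc 1 M, a m * conj (a m') *
            weilArchTerm (weilTranslate ψε (Real.log (m : ℝ) - Real.log (m' : ℝ))) =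
          ((‖a m‖ ^ 2 : ℝ) : ℂ) * weilArchTerm ψε +
            ∑ m' ∈ (Finset.Icc 1 M).erase m, a m * conj (a m') *
              weilArchTerm (weilTranslate ψε (Real.log (m : ℝ) - Real.log (m' : ℝ))) := by
      intro m hm
      rw [← Finset.add_sum_erase _ _ hm, sub_self, hT0, Complex.mul_conj']
      push_cast
      ring
    rw [Finset.sum_congr rfl e, Finset.sum_add_distrib, Complex.add_re, Complex.re_sum]
    congr 1
    rw [hL, Finset.sum_mul]
    refine Finset.sum_congr rfl fun m _ => ?_
    rw [Complex.re_ofReal_mul]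
  -- Step 3: `Re Q = Re P − ε⁻¹ N H + (L Wd + Off)`
  have hQ : (weilQuadratic (fun x : ℝ => ∑ m ∈ Finset.Icc 1 M,
        a m * ((ε : ℂ)⁻¹ * φ ((x - Real.log (m : ℝ)) / ε)))).re =
      (weilPolarTerm (weilConv (fun x : ℝ => ∑ m ∈ Finset.Icc 1 M,
          a m * ((ε : ℂ)⁻¹ * φ ((x - Real.log (m : ℝ)) / ε)))
        (weilReflect (fun x : ℝ => ∑ m ∈ Finset.Icc 1 M,
          a m * ((ε : ℂ)⁻¹ * φ ((x - Real.log (m : ℝ)) / ε)))))).re - ε⁻¹ * N * H + (L * Wd + Off) := by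
    simp only [weilQuadratic, weilFunctional, Complex.add_re, Complex.sub_re]
    rw [hPrime, Complex.ofReal_re, hdiagsplit]
  -- Step 4: the sharp diagonal
  have hWd : ε⁻¹ * N * (Real.log (1 / ε) - 5 / 2) - N * (9 + 3 * Real.log (1 / ε)) ≤ Wd := by
    have h := re_weilArchTerm_autocorr_ge_sharp hφεW hε hε4 hsε
    have hNε : weilNorm2Sq φε = ε⁻¹ * N := weilNorm2Sq_dil φ hε
    rw [hNε] at h
    have e : (Real.log (1 / ε) - 5 / 2) * (ε⁻¹ * N) - ε * (9 + 3 * Real.log (1 / ε)) * (ε⁻¹ * N) =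
        ε⁻¹ * N * (Real.log (1 / ε) - 5 / 2) - N * (9 + 3 * Real.log (1 / ε)) := by
      field_simp
    rw [e] at h
    exact h
  -- Step 5: the off-diagonal entries
  have hgap : ∀ m ∈ Finset.Icc 1 M, ∀ m' ∈ (Finset.Icc 1 M).erase m,
      4 * ε ≤ |Real.log (m : ℝ) - Real.log (m' : ℝ)| := by
    intro m hm m' hm'
    obtain ⟨hm1, hmM⟩ := Finset.mem_Icc.1 hm
    obtain ⟨hne, hm'I⟩ := Finset.mem_erase.1 hm'
    obtain ⟨hm'1, hm'M⟩ := Finset.mem_Icc.1 hm'I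
    rcases lt_or_gt_of_ne hne with hlt | hgt
    · -- m' < m
      have hg := log_sub_log_ge_inv hm'1 hlt
      have h1 : 1 / (M : ℝ) ≤ 1 / ((m' : ℝ) + 1) := by
        apply one_div_le_one_div_of_le (by positivity)
        exact_mod_cast (Nat.succ_le_of_lt (lt_of_lt_of_le hlt hmM))
      have hpos : 0 ≤ Real.log (m : ℝ) - Real.log (m' : ℝ) := by linarith [h1, hg, h4M, hε.le]
      rw [abs_of_nonneg hpos]
      linarith
    · -- m < m'
      have hg := log_sub_log_ge_inv hm1 hgt
      have h1 : 1 / (M : ℝ) ≤ 1 / ((m : ℝ) + 1) := by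
        apply one_div_le_one_div_of_le (by positivity)
        exact_mod_cast (Nat.succ_le_of_lt (lt_of_lt_of_le hgt hm'M))
      have hpos : 0 ≤ Real.log (m' : ℝ) - Real.log (m : ℝ) := by linarith [h1, hg, h4M, hε.le]
      rw [abs_sub_comm, abs_of_nonneg hpos]
      linarith
  have hentry : ∀ m ∈ Finset.Icc 1 M, ∀ m' ∈ (Finset.Icc 1 M).erase m,
      -(I ^ 2 * (‖a m‖ * ‖a m'‖ / |Real.log (m : ℝ) - Real.log (m' : ℝ)|) + I ^ 2 * (‖a m‖ * ‖a m'‖)) ≤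
        (a m * conj (a m') * weilArchTerm (weilTranslate ψε (Real.log (m : ℝ) - Real.log (m' : ℝ)))).re := by
    intro m hm m' hm'
    have hW := stub_archOffdiag φ hφ hsupp ε hε _ (hgap m hm m' hm')
    set w : ℂ := weilArchTerm (weilTranslate ψε (Real.log (m : ℝ) - Real.log (m' : ℝ))) with hw
    have h1 := Complex.abs_re_le_norm (a m * conj (a m') * w)
    have h2 : ‖a m * conj (a m') * w‖ = ‖a m‖ * ‖a m'‖ * ‖w‖ := by
      rw [norm_mul, norm_mul, Complex.norm_conj]
    have h3 : ‖a m‖ * ‖a m'‖ * ‖w‖ ≤ ‖a m‖ * ‖a m'‖ * (I ^ 2 * (1 / |Real.log (m : ℝ) - Real.log (m' : ℝ)| + 1)) :=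
      mul_le_mul_of_nonneg_left hW (mul_nonneg (norm_nonneg _) (norm_nonneg _))
    have h4 := (abs_le.1 h1).1
    rw [h2] at h4
    have e : ‖a m‖ * ‖a m'‖ * (I ^ 2 * (1 / |Real.log (m : ℝ) - Real.log (m' : ℝ)| + 1)) =
        I ^ 2 * (‖a m‖ * ‖a m'‖ / |Real.log (m : ℝ) - Real.log (m' : ℝ)|) + I ^ 2 * (‖a m‖ * ‖a m'‖) := by
      ring
    linarith
  have hOffb : -(I ^ 2 * (B + S ^ 2)) ≤ Off := by
    have hsum : ∑ m ∈ Finset.Icc 1 M, ∑ m' ∈ (Finset.Icc 1 M).erase m,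
        -(I ^ 2 * (‖a m‖ * ‖a m'‖ / |Real.log (m : ℝ) - Real.log (m' : ℝ)|) + I ^ 2 * (‖a m‖ * ‖a m'‖)) ≤
        ∑ m ∈ Finset.Icc 1 M, ∑ m' ∈ (Finset.Icc 1 M).erase m,
          (a m * conj (a m') * weilArchTerm (weilTranslate ψε (Real.log (m : ℝ) - Real.log (m' : ℝ)))).re :=
      Finset.sum_le_sum fun m hm => Finset.sum_le_sum fun m' hm' => hentry m hm m' hm'
    have hre : Off = ∑ m ∈ Finset.Icc 1 M, ∑ m' ∈ (Finset.Icc 1 M).erase m,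
        (a m * conj (a m') * weilArchTerm (weilTranslate ψε (Real.log (m : ℝ) - Real.log (m' : ℝ)))).re := by
      rw [hOff, Complex.re_sum]
      exact Finset.sum_congr rfl fun m _ => Complex.re_sum _ _
    have hlhs : ∑ m ∈ Finset.Icc 1 M, ∑ m' ∈ (Finset.Icc 1 M).erase m,
        -(I ^ 2 * (‖a m‖ * ‖a m'‖ / |Real.log (m : ℝ) - Real.log (m' : ℝ)|) + I ^ 2 * (‖a m‖ * ‖a m'‖)) =
        -(I ^ 2 * B + I ^ 2 * ∑ m ∈ Finset.Icc 1 M, ∑ m' ∈ (Finset.Icc 1 M).erase m, ‖a m‖ * ‖a m'‖) := by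
      rw [hB, Finset.mul_sum, Finset.mul_sum, ← Finset.sum_add_distrib, ← Finset.sum_neg_distrib]
      refine Finset.sum_congr rfl fun m _ => ?_
      rw [Finset.mul_sum, Finset.mul_sum, ← Finset.sum_add_distrib, ← Finset.sum_neg_distrib]
    have hP2 : ∑ m ∈ Finset.Icc 1 M, ∑ m' ∈ (Finset.Icc 1 M).erase m, ‖a m‖ * ‖a m'‖ ≤ S ^ 2 := by
      calc ∑ m ∈ Finset.Icc 1 M, ∑ m' ∈ (Finset.Icc 1 M).erase m, ‖a m‖ * ‖a m'‖
          ≤ ∑ m ∈ Finset.Icc 1 M, ∑ m' ∈ Finset.Icc 1 M, ‖a m‖ * ‖a m'‖ :=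
            Finset.sum_le_sum fun m _ =>
              Finset.sum_le_sum_of_subset_of_nonneg (Finset.erase_subset _ _) fun _ _ _ => by positivity
        _ = S ^ 2 := by rw [hS, sq, Finset.sum_mul_sum]
    have hI0 : 0 ≤ I ^ 2 := sq_nonneg _
    have := mul_le_mul_of_nonneg_left hP2 hI0
    rw [hre]
    refine le_trans ?_ hsum
    rw [hlhs]
    nlinarith
  -- Step 6: assemble
  have hS2 : S ^ 2 ≤ (M : ℝ) * L := by
    have h := sq_sum_le_card_mul_sum_sq (s := Finset.Icc 1 M) (f := fun m => ‖a m‖)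
    rw [Nat.card_Icc, Nat.add_sub_cancel] at h
    simpa [hS, hL] using h
  have hQp0 : 0 ≤ Qp := by
    refine Finset.sum_nonneg fun m hm => ?_
    have hm1 : (1 : ℝ) ≤ m := by exact_mod_cast (Finset.mem_Icc.1 hm).1
    have : 0 ≤ Real.log m := Real.log_nonneg hm1
    positivity
  have hN0 : 0 ≤ N := weilNorm2Sq_nonneg _
  have hL0 : 0 ≤ L := Finset.sum_nonneg fun m _ => sq_nonneg _
  have hD0 : 0 ≤ D := Finset.sum_nonneg fun m _ => Finset.sum_nonneg fun n _ =>
    mul_nonneg ArithmeticFunction.vonMangoldt_nonneg (sq_nonneg _)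
  have hB0 : 0 ≤ B := Finset.sum_nonneg fun m _ => Finset.sum_nonneg fun m' _ =>
    div_nonneg (mul_nonneg (norm_nonneg _) (norm_nonneg _)) (abs_nonneg _)
  have hAm0 : 0 ≤ Am := Finset.sum_nonneg fun m _ => div_nonneg (norm_nonneg _) (Real.sqrt_nonneg _)
  have hAp0 : 0 ≤ Ap := Finset.sum_nonneg fun m _ => mul_nonneg (norm_nonneg _) (Real.sqrt_nonneg _)
  exact assemble_gen (ε := ε) (Mr := (M : ℝ)) (N := N) (I := I) (L := L) (D := D) (Qp := Qp) (B := B) (S := S)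
    (Am := Am) (Ap := Ap) (V := V) (H := H) (Wd := Wd) (Off := Off)
    hε hMr hlam hN0 hI2 hL0 hD0 hQp0 hB0 hS2 hAm0 hAp0 hA2 hPoinc hBle hVle hId hQ hP hWd hOffb

/-- The effective theorem implies the route's Theorem A `WeilComb.CombSubcritical` (with `c₀ = 1/128`). [folklore] -/
theorem combSubcritical_of_effective :
    Summit.RiemannHypothesis.RiemannHypothesis.Theses.WeilComb.CombSubcritical :=
  ⟨1 / 128, by norm_num, fun φ hφ hsupp ε hε M a h => combSubcritical_effective φ hφ hsupp ε hε M a h⟩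

end Summit.RiemannHypothesis.RiemannHypothesis.Theorems.WeilCombBohrFejer

end
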